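import Summits.NavierStokesRegularity.FluidComputer.GateBudgetCleanHorizonWindingHeadline
import HarnessLib

/-!
# GateBudget part 123 — the dud horizon in TIME, hypothesis-minimal (§324–§326)

Cell `pub-fluidc`, blueprint seat bp1 (gen 41); namespace
`Summit.NavierStokesRegularity.FluidComputer.GateBudget`; the lattice member
`RotorKnob.rotorCircuit K K¹⁰ (kK¹⁰ρ²) ρ` of winding number `k` — Tao's five-mode circuit (5.5)
with `M = K¹⁰` — along its exact trajectory `X` from `delayInit` (5.6). HONEST FRAMING: a low
prior, high value-of-information experiment on Tao's machine paradigm; NOT a claim that NS blows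
up. Nothing here is about the Navier–Stokes equations: these are inequalities about the toy
circuit (5.5)/(5.6), in the time variable of (5.5).

WHY (statement hygiene, the time axis). Parts 118–122 state the dud horizon as a COUNT of clean
misfires (`cleanHorizon`), and the time-domain statements in the tree (part 68 §212, part 83
§244, part 98 §273 `knob_ladder_no_output_pair`) carry the ladder's scaffolding (a trigger
primitive, a separately quantified `ε`, an admissible window length `N`) and the pair ladder's
floor `≈ 0.034K⁹`. This file states the same fact ON THE TIME AXIS with the swing floor and with the
hypotheses of part 119 / part 122 only: the ODE (5.5) from (5.6), `K ≥ 16`, `0 < ρ`, the winding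
number and one smallness condition on `ρ`.

* §324 `output_dud_of_run` — THE READOUT IN TIME (any member, any `K ≥ 0`): the output mode
  `ã = X·4` is non-decreasing (`∂ₜã = Kd² ≥ 0`, `RotorKnob.rotorCircuit_output_monotone`) and
  `ã(0) = 0`; so if at some time `s ≥ T` the transferred energy `P(s) = d(s)² + ã(s)²` is `≤ 1/50`,
  then `0 ≤ ã(t)` and `ã(t)² ≤ 1/50` for every `t ∈ [0, T]`.
* §325 `ceil_run_numerics` — arithmetic of the run length `N₀ = ⌈c₀⌉` (`0 < c₀`,
  `c₀ + 1 ≤ K⁹`): `1 ≤ N₀`, `c₀ ≤ N₀ < c₀ + 1`, `log N₀ ≤ 9 log K`; and `log_le_linear_sixteen`: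
  `log K ≤ (2773/16000)·K` for `K ≥ 16` (`Real.log_div_self_antitoneOn`, as parts 118/121).
* §326 `knob_output_dud_time` — THE HEADLINE MEMBER IS A DUD FOR `0.065K⁹` TIME UNITS
  (`k = 1`; `K ≥ 16`, `0 < ρ`, `ρ⁴ ≤ 1/(6K⁴⁰)`, (5.5) for `rotorCircuit K K¹⁰ (K¹⁰ρ²) ρ` from
  (5.6)): `0 ≤ ã(t)` and `ã(t)² ≤ 1/50` for all `t ∈ [0, 0.065K⁹ + 1]` — part 118 §312's clean
  run of length `N₀ = ⌈0.065K⁹⌉` (its `n`-th ignition happens after time `1.8282 + (n + 1)`,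
  `P ≤ 1/50` there), read by §324; `knob_output_dud_time_winding` — EVERY MEMBER `1 ≤ k ≤ K`
  (`ρ⁴ ≤ 1/(6k²K⁴⁰)`, (5.5) for `rotorCircuit K K¹⁰ (kK¹⁰ρ²) ρ`): the same for all
  `t ∈ [0, K⁹/(10·(7/2 + k²/3 + 10⁻³)) + 1]` (part 121 §320's clean run, part 122 §322's lattice
  numerics); `knob_output_dud_time_order` — rounded: all `t ∈ [0, 3K⁹/(106 + 10k²)]`.

WHAT THIS SAYS (and does not). From Tao's initial datum (5.6) — all energy in the carrier — the
machine (5.5) with `M = K¹⁰` on the lattice `ε = kK¹⁰ρ²` delivers LESS THAN 2% of the energy to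
its output mode during the first `0.065K⁹` time units (`k = 1`; `3K⁹/(106 + 10k²)` at winding
number `k ≤ K`): a polynomially long delay, against the `≈ √2` arming time of the first pulse
(part 2 `taoFamily_no_early_output`). HONEST LIMITS: (i) ONE-SIDED IN TIME — the ceiling
`K⁹/7 + 1` of parts 118–122 bounds the NUMBER of clean misfires, not the time of delivery: the
rung invariant certifies at least one time unit per clean cycle (`r_{n+1} ≥ rₙ + 1`) and no upper
bound on the cycle, so no statement of the form "the output arrives before time `T`" is claimed;
(ii) the time floor undercounts by the same token (one unit per cycle; the clock's return from
`b ≤ -(31/32)θε` to `+θε` at rate `≤ ε·a² ≤ ε` alone takes `≥ 2.4` units — not typed); (iii) at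
`k = 1` the floor is the swing ladder's `0.065K⁹` (its per-rung ceiling entered with `U = 2`,
part 118); at general `k` it is the crude price's `K⁹/(10(7/2 + k²/3 + 10⁻³))`; (iv) nothing
about NS.
[cite: Tao2016AveragedNS, §5.5 Theorem 5.3, (5.5), (5.6), (ta-eq), (energy-con)]
-/

noncomputable section

namespace Summit.NavierStokesRegularity.FluidComputer.GateBudget

open Real Set Filter Topology
open Literature.Analysis.FluidPDE.Tao2016AveragedNS

variable {K M ε ρ : ℝ} {X : ℝ → Fin 5 → ℝ}

/-! ## §324 The readout in time -/

/-- §324 THE READOUT IN TIME (any member `rotorCircuit K M ε ρ`, `K ≥ 0`, from `delayInit`): if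
`T ≤ s` and `d(s)² + ã(s)² ≤ 1/50`, then `0 ≤ ã(t)` and `ã(t)² ≤ 1/50` for all `t ∈ [0, T]` — the
output mode is non-decreasing (`∂ₜã = Kd²`) and starts at `0`.
[derived: `RotorKnob.rotorCircuit_output_monotone`, `init_e`] -/
theorem output_dud_of_run (hK : 0 ≤ K)
    (hX : ∀ t, HasDerivAt X (RotorKnob.rotorCircuit K M ε ρ (X t)) t) (h0 : X 0 = delayInit)
    {s T : ℝ} (hsT : T ≤ s) (hP : X s 3 ^ 2 + X s 4 ^ 2 ≤ 1 / 50) :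
    ∀ t ∈ Icc (0 : ℝ) T, 0 ≤ X t 4 ∧ X t 4 ^ 2 ≤ 1 / 50 := by
  have hmono := RotorKnob.rotorCircuit_output_monotone hK hX
  have he : X 0 4 = 0 := by simp [h0, delayInit]
  intro t ht
  have h0t : 0 ≤ X t 4 := by simpa only [he] using hmono ht.1
  have hts : X t 4 ≤ X s 4 := hmono (ht.2.trans hsT)
  refine ⟨h0t, ?_⟩
  have h2 : X t 4 ^ 2 ≤ X s 4 ^ 2 := pow_le_pow_left₀ h0t hts 2
  nlinarith only [h2, hP, sq_nonneg (X s 3)]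

/-! ## §325 Arithmetic of the run length -/

/-- §325 `log K ≤ (log 16/16)·K ≤ (2773/16000)·K` for `K ≥ 16` (`t ↦ log t/t` is antitone on
`[e, ∞)`). [folklore] -/
theorem log_le_linear_sixteen (hK : 16 ≤ K) : log K ≤ 2773 / 16000 * K := by
  have hK0 : (0 : ℝ) < K := by linarith
  have he16 : exp 1 ≤ 16 := by have := Real.exp_one_lt_d9; linarith
  have hmono := Real.log_div_self_antitoneOn (show (16 : ℝ) ∈ Set.Ici (exp 1) from he16)
    (show K ∈ Set.Ici (exp 1) from le_trans he16 hK) hK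
  simp only at hmono
  have hlog16 : log 16 ≤ 2773 / 1000 := by
    have e : log (16 : ℝ) = 4 * log 2 := by
      rw [show (16 : ℝ) = 2 ^ 4 by norm_num, Real.log_pow]; norm_num
    rw [e]; linarith only [Real.log_two_lt_d9]
  rw [div_le_iff₀ hK0] at hmono
  have := mul_le_mul_of_nonneg_right (div_le_div_of_nonneg_right hlog16 (by norm_num :
    (0 : ℝ) ≤ 16)) hK0.le
  linarith only [hmono, this]

/-- §325 THE RUN LENGTH `N₀ = ⌈c₀⌉` (arithmetic; `0 < c₀`, `c₀ + 1 ≤ K⁹`): `1 ≤ N₀`,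
`c₀ ≤ N₀ < c₀ + 1` and `log N₀ ≤ 9 log K`. [folklore] -/
theorem ceil_run_numerics {c₀ : ℝ} (hc₀ : 0 < c₀) (hc₀K : c₀ + 1 ≤ K ^ 9) :
    1 ≤ ⌈c₀⌉₊ ∧ c₀ ≤ (⌈c₀⌉₊ : ℝ) ∧ (⌈c₀⌉₊ : ℝ) < c₀ + 1 ∧ log (⌈c₀⌉₊ : ℝ) ≤ 9 * log K := by
  have hle : c₀ ≤ (⌈c₀⌉₊ : ℝ) := Nat.le_ceil _
  have hlt : (⌈c₀⌉₊ : ℝ) < c₀ + 1 := Nat.ceil_lt_add_one hc₀.le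
  have hposR : (0 : ℝ) < ⌈c₀⌉₊ := lt_of_lt_of_le hc₀ hle
  have hpos : 1 ≤ ⌈c₀⌉₊ := Nat.succ_le_of_lt (by exact_mod_cast hposR)
  refine ⟨hpos, hle, hlt, ?_⟩
  have hNK : (⌈c₀⌉₊ : ℝ) ≤ K ^ 9 := by linarith only [hlt, hc₀K]
  have h := Real.log_le_log hposR hNK
  have h9 : log (K ^ 9) = 9 * log K := by rw [Real.log_pow]; norm_num
  linarith only [h, h9]

variable {K ρ : ℝ} {X : ℝ → Fin 5 → ℝ}

/-! ## §326 The dud horizon in time -/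

/-- §326 **THE HEADLINE MEMBER IS A DUD FOR `0.065K⁹` TIME UNITS** (`k = 1`; hypotheses ONLY:
`K ≥ 16`, `0 < ρ`, `ρ⁴ ≤ 1/(6K⁴⁰)`, and `X` solves Tao's circuit `rotorCircuit K K¹⁰ (K¹⁰ρ²) ρ`
(5.5) from `delayInit` (5.6)): for every `t ∈ [0, 0.065K⁹ + 1]`, `0 ≤ ã(t)` and `ã(t)² ≤ 1/50` —
less than 2% of the (unit, conserved) energy has reached the output. Part 118 §312's clean run at
`N₀ = ⌈0.065K⁹⌉` (inside the log-free √-window: `(N₀ - 1)·2/K⁹ ≤ 0.13`, `141·9 log K/(5K⁴) ≤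
0.0109`) has its last ignition after time `1.8282 + N₀` with `P ≤ 1/50` there; §324 reads it out.
[derived: part 118 §312, part 122 §322, part 14 (`exists_catalyst_primitive`), §324, §325] -/
theorem knob_output_dud_time (hK : 16 ≤ K) (hρ : 0 < ρ) (hρK : ρ ^ 4 ≤ 1 / (6 * K ^ 40))
    (hX : ∀ t, HasDerivAt X (RotorKnob.rotorCircuit K (K ^ 10) (K ^ 10 * ρ ^ 2) ρ (X t)) t)
    (h0 : X 0 = delayInit) :
    ∀ t ∈ Icc (0 : ℝ) (65 / 1000 * K ^ 9 + 1), 0 ≤ X t 4 ∧ X t 4 ^ 2 ≤ 1 / 50 := by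
  have hK0 : (0 : ℝ) < K := by linarith
  have hK9 : (0 : ℝ) < K ^ 9 := by positivity
  obtain ⟨C, hC⟩ := exists_catalyst_primitive hX
  obtain ⟨hε, hεK, -, -⟩ := winding_lattice_numerics hK hρ (k := 1) le_rfl
    (by norm_num; linarith only [hK]) (by simpa using hρK)
  simp only [Nat.cast_one, one_mul] at hε hεK
  have hK9big : (68719476736 : ℝ) ≤ K ^ 9 := by
    have := pow_le_pow_left₀ (by norm_num : (0 : ℝ) ≤ 16) hK 9; norm_num at this; exact this
  have hK3 : (4096 : ℝ) ≤ K ^ 3 := by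
    have := pow_le_pow_left₀ (by norm_num : (0 : ℝ) ≤ 16) hK 3; norm_num at this; exact this
  -- the run length `N₀ = ⌈0.065K⁹⌉`
  have hc₀ : (0 : ℝ) < 65 / 1000 * K ^ 9 := by positivity
  obtain ⟨hN₀pos, hN₀le, hN₀lt, hlogN⟩ :=
    ceil_run_numerics hc₀ (by linarith only [hK9big] : 65 / 1000 * K ^ 9 + 1 ≤ K ^ 9)
  -- the log term of the window: `141·9 log K/(5K⁴) ≤ 0.0109`
  have hl := log_le_linear_sixteen hK
  have hlogt : 141 / (5 * K ^ 4) * (9 * log K) ≤ 109 / 10000 := by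
    rw [div_mul_eq_mul_div, div_le_iff₀ (by positivity)]
    have h2 : 1269 * (2773 / 16000) ≤ 109 / 10000 * 5 * K ^ 3 := by linarith only [hK3]
    calc 141 * (9 * log K) ≤ 1269 * (2773 / 16000) * K := by linarith only [hl]
      _ ≤ 109 / 10000 * 5 * K ^ 3 * K := mul_le_mul_of_nonneg_right h2 hK0.le
      _ = 109 / 10000 * (5 * K ^ 4) := by ring
  -- the √-window at `N₀`
  have hwin : ((⌈65 / 1000 * K ^ 9⌉₊ : ℝ) - 1) * (2 / K ^ 9)
      + (14 * ((1 : ℕ) : ℝ) + 127) / (5 * K ^ 4) * log (⌈65 / 1000 * K ^ 9⌉₊ : ℝ)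
      ≤ 1409 / 10000 := by
    have e1 : (14 * ((1 : ℕ) : ℝ) + 127) / (5 * K ^ 4) = 141 / (5 * K ^ 4) := by norm_num
    have hcM0 : (0 : ℝ) ≤ 141 / (5 * K ^ 4) := by positivity
    have h1 : ((⌈65 / 1000 * K ^ 9⌉₊ : ℝ) - 1) * (2 / K ^ 9) ≤ 13 / 100 := by
      have h := mul_le_mul_of_nonneg_right
        (le_of_lt (by linarith only [hN₀lt] :
          (⌈65 / 1000 * K ^ 9⌉₊ : ℝ) - 1 < 65 / 1000 * K ^ 9))
        (by positivity : (0 : ℝ) ≤ 2 / K ^ 9)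
      have e : 65 / 1000 * K ^ 9 * (2 / K ^ 9) = 13 / 100 := by field_simp; ring
      linarith only [h, e]
    have h2 := mul_le_mul_of_nonneg_left hlogN hcM0
    rw [e1]; linarith only [h1, h2, hlogt]
  obtain ⟨r, θ, -, hrun⟩ := knob_clean_run_swing hX h0 hC hK hε hεK hρ 1
    (by push_cast; ring) rfl _ hN₀pos hwin
  -- the last ignition of the run, after time `1.8282 + N₀ ≥ 0.065K⁹ + 1.8282`
  obtain ⟨hr, -, -, -, -, -, hP, -, -, -⟩ := hrun (⌈65 / 1000 * K ^ 9⌉₊ - 1) (by omega)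
  have hcast : (((⌈65 / 1000 * K ^ 9⌉₊ - 1 : ℕ) : ℝ) + 1) = (⌈65 / 1000 * K ^ 9⌉₊ : ℝ) := by
    rw [Nat.cast_sub hN₀pos]; push_cast; ring
  rw [hcast] at hr
  exact output_dud_of_run hK0.le hX h0 (by linarith only [hr, hN₀le]) hP

/-- §326 **EVERY MEMBER `1 ≤ k ≤ K` IS A DUD FOR `K⁹/(10·(7/2 + k²/3 + 10⁻³))` TIME UNITS**
(hypotheses ONLY: `K ≥ 16`, `0 < ρ`, winding number `1 ≤ k ≤ K`, `ρ⁴ ≤ 1/(6k²K⁴⁰)`, and `X`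
solves `rotorCircuit K K¹⁰ (kK¹⁰ρ²) ρ` (5.5) from `delayInit` (5.6)): for every
`t ∈ [0, K⁹/(10·(7/2 + k²/3 + 10⁻³)) + 1]`, `0 ≤ ã(t)` and `ã(t)² ≤ 1/50`. Part 121 §320's clean
run at `N₀ = ⌈K⁹/(10·(7/2 + k²/3 + 10⁻³))⌉` (window: linear term `≤ 1/10`, log term
`(14k + 127)·9 log K/(5K⁴) ≤ 0.0409` for `k ≤ K`), read by §324.
[derived: part 121 §320, part 122 §322, part 14 (`exists_catalyst_primitive`), §324, §325] -/
theorem knob_output_dud_time_winding (hK : 16 ≤ K) (hρ : 0 < ρ) (k : ℕ) (hk1 : 1 ≤ k)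
    (hkK : (k : ℝ) ≤ K) (hρK : ρ ^ 4 ≤ 1 / (6 * k ^ 2 * K ^ 40))
    (hX : ∀ t, HasDerivAt X (RotorKnob.rotorCircuit K (K ^ 10) (k * K ^ 10 * ρ ^ 2) ρ (X t)) t)
    (h0 : X 0 = delayInit) :
    ∀ t ∈ Icc (0 : ℝ) (K ^ 9 / (10 * (7 / 2 + k ^ 2 / 3 + 1 / 1000)) + 1),
      0 ≤ X t 4 ∧ X t 4 ^ 2 ≤ 1 / 50 := by
  have hK0 : (0 : ℝ) < K := by linarith
  have hK9 : (0 : ℝ) < K ^ 9 := by positivity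
  have hk0 : (0 : ℝ) ≤ k := Nat.cast_nonneg k
  have hK2 : (256 : ℝ) ≤ K ^ 2 := by nlinarith only [hK]
  have hkK2 : (k : ℝ) ≤ K ^ 2 := hkK.trans (by nlinarith only [hK, hK2])
  obtain ⟨C, hC⟩ := exists_catalyst_primitive hX
  obtain ⟨hε, hεK, hlo, hhi⟩ := winding_lattice_numerics hK hρ hk1 hkK hρK
  have hK9big : (68719476736 : ℝ) ≤ K ^ 9 := by
    have := pow_le_pow_left₀ (by norm_num : (0 : ℝ) ≤ 16) hK 9; norm_num at this; exact this
  -- the run length `N₀ = ⌈c₀⌉`, `c₀ = K⁹/(10(7/2 + k²/3 + 10⁻³)) ≤ K⁹/35`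
  obtain ⟨c₀, hc₀_def⟩ : ∃ c₀ : ℝ, c₀ = K ^ 9 / (10 * (7 / 2 + k ^ 2 / 3 + 1 / 1000)) :=
    ⟨_, rfl⟩
  rw [← hc₀_def]
  have hc₀0 : 0 < c₀ := by rw [hc₀_def]; positivity
  have hc₀K : c₀ ≤ K ^ 9 / 35 := by
    rw [hc₀_def]
    exact div_le_div_of_nonneg_left hK9.le (by norm_num) (by nlinarith only [sq_nonneg (k : ℝ)])
  obtain ⟨hN₀pos, hN₀le, hN₀lt, hlogN⟩ :=
    ceil_run_numerics hc₀0 (by linarith only [hc₀K, hK9big] : c₀ + 1 ≤ K ^ 9)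
  -- the log term of the window: `(14k + 127)·9 log K/(5K⁴) ≤ 0.0409`
  have hl := log_le_linear_sixteen hK
  have hlogt : (14 * k + 127) / (5 * K ^ 4) * (9 * log K) ≤ 409 / 10000 := by
    rw [div_mul_eq_mul_div, div_le_iff₀ (by positivity)]
    have h22 : (14 * k + 127 : ℝ) ≤ 22 * K := by linarith only [hkK, hK]
    have hlogK : 0 ≤ log K := Real.log_nonneg (by linarith only [hK])
    have hK4 : 256 * K ^ 2 ≤ K ^ 4 := by nlinarith only [hK2]
    calc (14 * k + 127) * (9 * log K) ≤ 22 * K * (9 * (2773 / 16000 * K)) :=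
          mul_le_mul h22 (by linarith only [hl]) (by positivity) (by positivity)
      _ = 549054 / 16000 * K ^ 2 := by ring
      _ ≤ 409 / 10000 * (5 * K ^ 4) := by linarith only [hK4, hK2]
  -- the √-window at `N₀`
  have hwin : ((⌈c₀⌉₊ : ℝ) - 1) * ((7 / 2 + k ^ 2 / 3 + 1 / 1000) / K ^ 9)
      + (14 * k + 127) / (5 * K ^ 4) * log (⌈c₀⌉₊ : ℝ) ≤ 1409 / 10000 := by
    have hcM0 : (0 : ℝ) ≤ (14 * k + 127) / (5 * K ^ 4) := by positivity
    have h1 : ((⌈c₀⌉₊ : ℝ) - 1) * ((7 / 2 + k ^ 2 / 3 + 1 / 1000) / K ^ 9) ≤ 1 / 10 := by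
      have h := mul_le_mul_of_nonneg_right
        (le_of_lt (by linarith only [hN₀lt] : (⌈c₀⌉₊ : ℝ) - 1 < c₀))
        (by positivity : (0 : ℝ) ≤ (7 / 2 + k ^ 2 / 3 + 1 / 1000) / K ^ 9)
      have e : c₀ * ((7 / 2 + k ^ 2 / 3 + 1 / 1000) / K ^ 9) = 1 / 10 := by
        rw [hc₀_def, div_mul_div_comm, div_eq_div_iff (by positivity) (by norm_num)]
        ring
      linarith only [h, e]
    have h2 := mul_le_mul_of_nonneg_left hlogN hcM0
    linarith only [h1, h2, hlogt]
  obtain ⟨r, θ, -, hrun⟩ :=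
    knob_clean_run_pair hX h0 hC hK hε hεK hρ hlo hhi k rfl hkK2 _ hN₀pos hwin
  -- the last ignition of the run, after time `1.8282 + N₀ ≥ c₀ + 1.8282`
  obtain ⟨hr, -, -, -, -, -, hP, -, -, -⟩ := hrun (⌈c₀⌉₊ - 1) (by omega)
  have hcast : (((⌈c₀⌉₊ - 1 : ℕ) : ℝ) + 1) = (⌈c₀⌉₊ : ℝ) := by
    rw [Nat.cast_sub hN₀pos]; push_cast; ring
  rw [hcast] at hr
  exact output_dud_of_run hK0.le hX h0 (by linarith only [hr, hN₀le]) hP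

/-- §326 **EVERY MEMBER IS A DUD FOR `3K⁹/(106 + 10k²)` TIME UNITS** (the same hypotheses; the
floor rounded down, `30·(7/2 + k²/3 + 10⁻³) = 105.03 + 10k² ≤ 106 + 10k²`): for every
`t ∈ [0, 3K⁹/(106 + 10k²)]`, `0 ≤ ã(t)` and `ã(t)² ≤ 1/50`.
[derived: this file `knob_output_dud_time_winding`] -/
theorem knob_output_dud_time_order (hK : 16 ≤ K) (hρ : 0 < ρ) (k : ℕ) (hk1 : 1 ≤ k)
    (hkK : (k : ℝ) ≤ K) (hρK : ρ ^ 4 ≤ 1 / (6 * k ^ 2 * K ^ 40))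
    (hX : ∀ t, HasDerivAt X (RotorKnob.rotorCircuit K (K ^ 10) (k * K ^ 10 * ρ ^ 2) ρ (X t)) t)
    (h0 : X 0 = delayInit) :
    ∀ t ∈ Icc (0 : ℝ) (3 * K ^ 9 / (106 + 10 * k ^ 2)), 0 ≤ X t 4 ∧ X t 4 ^ 2 ≤ 1 / 50 := by
  intro t ht
  have hK9 : (0 : ℝ) ≤ K ^ 9 := by positivity
  have hle : 3 * K ^ 9 / (106 + 10 * k ^ 2) ≤ K ^ 9 / (10 * (7 / 2 + k ^ 2 / 3 + 1 / 1000)) := by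
    rw [div_le_div_iff₀ (by positivity) (by positivity)]
    linarith only [hK9]
  exact knob_output_dud_time_winding hK hρ k hk1 hkK hρK hX h0 t
    ⟨ht.1, by linarith only [ht.2, hle]⟩

end Summit.NavierStokesRegularity.FluidComputer.GateBudget

end
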